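import Mathlib
import Summits.ValiantsHypothesis.ValiantsHypothesis.Theorems.DivisionGapTriangularDimersDivisionEasyOddJoinDefs

/-!
# Crux `DivisionGap.TriangularDimersDivisionEasy` (stmt-ValiantsHypothesis-5067), line `Sketch` —
registered stub `stub_boundAbsorb`

POLYNOMIAL OVERHEADS ARE ABSORBED BY THE QUASI-POLYNOMIAL THRESHOLD: for the crux's threshold
`bound c n = 2 ^ ((log₂ n + c) ^ c)` and any `k d : ℕ` there is a constant `c'` (namely
`c' = c + k + d + 2`) with `bound c n + k * n ^ d + k ≤ bound c' n` for every `n`.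

## Proof

Elementary arithmetic (no citation applies).  Write `L = log₂ n` and `M = L + c'`.
* `n < 2 ^ (L + 1)` (`Nat.lt_pow_succ_log_self`), hence `n ^ d ≤ 2 ^ ((L + 1) d)` and, with
  `k ≤ 2 ^ k`, `k * n ^ d + k = k (n ^ d + 1) ≤ 2 ^ k · 2 ^ ((L + 1) d + 1) = 2 ^ B`,
  `B = k + (L + 1) d + 1`.
* Both exponents `A = (L + c) ^ c` and `B` are `≥ 1`, so `2 ^ A + 2 ^ B ≤ 2 ^ A · 2 ^ B = 2 ^ (A + B)`.
* `A + B ≤ M ^ c'`: `A ≤ M ^ c`, `B + 1 ≤ M · M` (expand `M · M = M · L + M · c'` and use `M ≥ d`,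
  `M ≥ 1`, `c' ≥ k + d + 2`), so `A + B ≤ M ^ c · B + M ^ c = M ^ c (B + 1) ≤ M ^ c · M ^ 2 =
  M ^ (c + 2) ≤ M ^ c'`.
-/

-- `Summit.ValiantsHypothesis.ValiantsHypothesis.…` is the tree's mandated single-conjunct layout (Sub = Summit).
set_option linter.dupNamespace false

namespace Summit.ValiantsHypothesis.ValiantsHypothesis.Theorems.TriangularDimersDivisionEasy.OddJoin

namespace BoundAbsorb
/-! ### Helper lemmas for `stub_boundAbsorb` (this stub's private namespace) -/

/-- The polynomial overhead is a single power of two in `log₂ n`: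
`k * n ^ d + k ≤ 2 ^ (k + (log₂ n + 1) * d + 1)`. [folklore] -/
theorem poly_overhead_le (k d n : ℕ) :
    k * n ^ d + k ≤ 2 ^ (k + (Nat.log 2 n + 1) * d + 1) := by
  set L := Nat.log 2 n with hL
  have hn : n < 2 ^ (L + 1) := Nat.lt_pow_succ_log_self one_lt_two n
  have hk : k ≤ 2 ^ k := (Nat.lt_two_pow_self (n := k)).le
  have h1 : n ^ d ≤ 2 ^ ((L + 1) * d) := by
    calc n ^ d ≤ (2 ^ (L + 1)) ^ d := Nat.pow_le_pow_left hn.le d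
      _ = 2 ^ ((L + 1) * d) := by rw [← pow_mul]
  have h2 : n ^ d + 1 ≤ 2 ^ ((L + 1) * d + 1) := by
    have h3 : 1 ≤ 2 ^ ((L + 1) * d) := Nat.one_le_two_pow
    rw [pow_succ]
    omega
  calc k * n ^ d + k = k * (n ^ d + 1) := by ring
    _ ≤ 2 ^ k * 2 ^ ((L + 1) * d + 1) := Nat.mul_le_mul hk h2
    _ = 2 ^ (k + (L + 1) * d + 1) := by rw [← pow_add, add_assoc]

/-- The exponent comparison: `(L + c) ^ c + (k + (L + 1) * d + 1) ≤ (L + c') ^ c'` for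
`c' = c + k + d + 2`. [folklore] -/
theorem exponent_le (c k d L : ℕ) :
    (L + c) ^ c + (k + (L + 1) * d + 1) ≤ (L + (c + k + d + 2)) ^ (c + k + d + 2) := by
  set M := L + (c + k + d + 2) with hM
  have hM1 : 1 ≤ M := by omega
  have hA : (L + c) ^ c ≤ M ^ c := Nat.pow_le_pow_left (by omega) c
  have hMc : 1 ≤ M ^ c := Nat.one_le_pow _ _ hM1
  have hB : k + (L + 1) * d + 1 + 1 ≤ M * M := by
    have e1 : d * L ≤ M * L := Nat.mul_le_mul_right L (by omega)
    have e2 : k + d + 2 ≤ M * (c + k + d + 2) :=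
      le_trans (by omega) (Nat.le_mul_of_pos_left (c + k + d + 2) hM1)
    calc k + (L + 1) * d + 1 + 1 = d * L + (k + d + 2) := by ring
      _ ≤ M * L + M * (c + k + d + 2) := Nat.add_le_add e1 e2
      _ = M * M := by rw [← mul_add]
  calc (L + c) ^ c + (k + (L + 1) * d + 1)
        = (k + (L + 1) * d + 1) + (L + c) ^ c := add_comm _ _
    _ ≤ M ^ c * (k + (L + 1) * d + 1) + M ^ c :=
        Nat.add_le_add (Nat.le_mul_of_pos_left _ hMc) hA
    _ = M ^ c * (k + (L + 1) * d + 1 + 1) := by ring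
    _ ≤ M ^ c * (M * M) := Nat.mul_le_mul_left _ hB
    _ = M ^ (c + 2) := by ring
    _ ≤ M ^ (c + k + d + 2) := Nat.pow_le_pow_right hM1 (by omega)

end BoundAbsorb

/-- **Registered stub `stub_boundAbsorb`**: polynomial overheads `k * n ^ d + k` are absorbed by the
quasi-polynomial threshold `bound c n = 2 ^ ((log₂ n + c) ^ c)` at the cost of enlarging the
constant, uniformly in `n` (take `c' = c + k + d + 2`). [folklore] -/
theorem stub_boundAbsorb (c k d : ℕ) : ∃ c' : ℕ, ∀ n : ℕ, bound c n + k * n ^ d + k ≤ bound c' n := by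
  refine ⟨c + k + d + 2, fun n => ?_⟩
  simp only [bound]
  have hP := BoundAbsorb.poly_overhead_le k d n
  have hE := BoundAbsorb.exponent_le c k d (Nat.log 2 n)
  have hA1 : 2 ≤ 2 ^ ((Nat.log 2 n + c) ^ c) := by
    rcases Nat.eq_zero_or_pos c with rfl | hc
    · simp
    · calc (2 : ℕ) = 2 ^ 1 := rfl
        _ ≤ 2 ^ ((Nat.log 2 n + c) ^ c) :=
          Nat.pow_le_pow_right two_pos (Nat.one_le_pow _ _ (by omega))
  have hB1 : 2 ≤ 2 ^ (k + (Nat.log 2 n + 1) * d + 1) :=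
    calc (2 : ℕ) = 2 ^ 1 := rfl
      _ ≤ 2 ^ (k + (Nat.log 2 n + 1) * d + 1) := Nat.pow_le_pow_right two_pos (by omega)
  calc 2 ^ ((Nat.log 2 n + c) ^ c) + k * n ^ d + k
        ≤ 2 ^ ((Nat.log 2 n + c) ^ c) + 2 ^ (k + (Nat.log 2 n + 1) * d + 1) := by omega
    _ ≤ 2 ^ ((Nat.log 2 n + c) ^ c) * 2 ^ (k + (Nat.log 2 n + 1) * d + 1) := add_le_mul hA1 hB1
    _ = 2 ^ ((Nat.log 2 n + c) ^ c + (k + (Nat.log 2 n + 1) * d + 1)) := (pow_add _ _ _).symm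
    _ ≤ 2 ^ ((Nat.log 2 n + (c + k + d + 2)) ^ (c + k + d + 2)) := Nat.pow_le_pow_right two_pos hE

end Summit.ValiantsHypothesis.ValiantsHypothesis.Theorems.TriangularDimersDivisionEasy.OddJoin
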